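import Literature.NumberTheory.LFunctions.PrimeNumberTheoremQuasiRHIff
import Literature.NumberTheory.LFunctions.QuasiRHFactsProofs
import HarnessLib

/-!
# RH-FREE: `M(x) = O(x^{Θ+ε}) ∀ε ⟺ ψ(x) − x = O(x^{Θ+ε}) ∀ε ⟺ ζ ≠ 0 on Re s > Θ` (Littlewood 1912 / Titchmarsh Thm. 14.25 / MV §15.1, for a general abscissa `1/2 ≤ Θ < 1`) — nothing here bears on the truth of RH

LABEL (line 1): RH-FREE literature. Topic `Literature/NumberTheory/LFunctions`. Everything here is PROVED; no
definition, no named fact. Status: classical (Littlewood, *C. R. Acad. Sci.* 154 (1912); Titchmarsh 1986 Thm. 14.25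
(A) ⇔ (B) ⇔ (C), printed for `Θ = 1/2`; Montgomery–Vaughan 2007 §15.1 and (15.10)); no endorsement of anything is
implied; nothing here bears on the truth of RH.

The tree holds the Mertens-function dictionary `mertens_isBigO_iff_forall_quasiRiemannHypothesis`
(`QuasiRHFactsProofs.lean`: for `1/2 ≤ θ < 1`, `(∀ ε > 0, M(x) = O(x^{θ+ε})) ↔ ∀ θ' ∈ (θ, 1), QuasiRiemannHypothesis θ'`)
and, from this seat, the `ψ` dictionary `chebyshevPsi_isBigO_iff_forall_quasiRiemannHypothesis`
(`PrimeNumberTheoremQuasiRHIff.lean`). This file joins them: for `1/2 ≤ Θ < 1` the three statements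
«`M(x) = O_ε(x^{Θ+ε})`», «`ψ(x) − x = O_ε(x^{Θ+ε})`», «`ϑ(x) − x = O_ε(x^{Θ+ε})`» are equivalent to each other and to
«`ζ(s) ≠ 0` for `Re s > Θ`» — Titchmarsh's Theorem 14.25 with `1/2` replaced by a general abscissa.

## References

* [Titchmarsh1986] E. C. Titchmarsh, *The Theory of the Riemann Zeta-Function*, 2nd ed. (1986), Thm. 14.25.
* [MontgomeryVaughan2007] H. L. Montgomery, R. C. Vaughan, *Multiplicative Number Theory I*, CUP 2007, §15.1
  (opening paragraph and (15.10)), §13.1.1 Exercise 1.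
-/

noncomputable section

open Filter Topology Asymptotics
open scoped Chebyshev

namespace Literature.NumberTheory.LFunctions

/-- The `θ' < 1` guard in the Mertens dictionary is immaterial (`QuasiRiemannHypothesis θ'` is vacuous for `θ' ≥ 1`).
[cite: Titchmarsh1986, Thm 14.25] -/
theorem forall_quasiRiemannHypothesis_iff_guarded (Θ : ℝ) :
    (∀ θ' : ℝ, Θ < θ' → QuasiRiemannHypothesis θ') ↔
      ∀ θ' : ℝ, Θ < θ' → θ' < 1 → QuasiRiemannHypothesis θ' := by
  constructor
  · exact fun h θ' hθ' _ ↦ h θ' hθ'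
  · intro h θ' hθ'
    rcases lt_or_ge θ' 1 with h1 | h1
    · exact h θ' hθ' h1
    · exact quasiRiemannHypothesis_one.mono h1

/-- **Titchmarsh Thm. 14.25 / MV §15.1 for a general abscissa**: for `1/2 ≤ Θ < 1`,
`M(x) = O(x^{Θ+ε})` for every `ε > 0` if and only if `ψ(x) − x = O(x^{Θ+ε})` for every `ε > 0`
(both being equivalent to `ζ(s) ≠ 0` for `Re s > Θ`). [cite: Titchmarsh1986, Thm 14.25] -/
theorem mertens_isBigO_iff_chebyshevPsi_isBigO {Θ : ℝ} (hΘ : 1 / 2 ≤ Θ) (hΘ1 : Θ < 1) :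
    (∀ ε : ℝ, 0 < ε →
        (fun x : ℝ ↦ (LFunctions.mertensFunction x : ℝ)) =O[atTop] fun x : ℝ ↦ x ^ (Θ + ε)) ↔
      ∀ ε : ℝ, 0 < ε → (fun x ↦ ψ x - x) =O[atTop] fun x : ℝ ↦ x ^ (Θ + ε) := by
  rw [mertens_isBigO_iff_forall_quasiRiemannHypothesis hΘ hΘ1,
    chebyshevPsi_isBigO_iff_forall_quasiRiemannHypothesis (by linarith : (0 : ℝ) ≤ Θ),
    forall_quasiRiemannHypothesis_iff_guarded]

/-- The `ϑ` variant: for `1/2 ≤ Θ < 1`, `M(x) = O_ε(x^{Θ+ε})` iff `ϑ(x) − x = O_ε(x^{Θ+ε})`.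
[cite: Titchmarsh1986, Thm 14.25] -/
theorem mertens_isBigO_iff_chebyshevTheta_isBigO {Θ : ℝ} (hΘ : 1 / 2 ≤ Θ) (hΘ1 : Θ < 1) :
    (∀ ε : ℝ, 0 < ε →
        (fun x : ℝ ↦ (LFunctions.mertensFunction x : ℝ)) =O[atTop] fun x : ℝ ↦ x ^ (Θ + ε)) ↔
      ∀ ε : ℝ, 0 < ε → (fun x ↦ θ x - x) =O[atTop] fun x : ℝ ↦ x ^ (Θ + ε) := by
  rw [mertens_isBigO_iff_forall_quasiRiemannHypothesis hΘ hΘ1,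
    chebyshevTheta_isBigO_iff_forall_quasiRiemannHypothesis hΘ, forall_quasiRiemannHypothesis_iff_guarded]

/-- The zero-free half-plane form: for `1/2 ≤ Θ < 1`, `ζ(s) ≠ 0` for `Θ < Re s < 1` implies all three error bounds
`M(x), ψ(x) − x, ϑ(x) − x = O(x^{Θ+ε})` for every `ε > 0`. [cite: MontgomeryVaughan2007, §15.1 (with (15.10))] -/
theorem errorTerms_isBigO_of_quasiRiemannHypothesis {Θ : ℝ} (hQ : QuasiRiemannHypothesis Θ) (hΘ : 1 / 2 ≤ Θ)
    (hΘ1 : Θ < 1) {ε : ℝ} (hε : 0 < ε) :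
    ((fun x : ℝ ↦ (LFunctions.mertensFunction x : ℝ)) =O[atTop] fun x : ℝ ↦ x ^ (Θ + ε)) ∧
      ((fun x ↦ ψ x - x) =O[atTop] fun x : ℝ ↦ x ^ (Θ + ε)) ∧
        ((fun x ↦ θ x - x) =O[atTop] fun x : ℝ ↦ x ^ (Θ + ε)) := by
  have hall : ∀ θ' : ℝ, Θ < θ' → QuasiRiemannHypothesis θ' := fun θ' hθ' ↦ hQ.mono hθ'.le
  exact ⟨(mertens_isBigO_iff_forall_quasiRiemannHypothesis hΘ hΘ1).2
      ((forall_quasiRiemannHypothesis_iff_guarded Θ).1 hall) ε hε,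
    (chebyshevPsi_isBigO_iff_forall_quasiRiemannHypothesis (by linarith)).2 hall ε hε,
    (chebyshevTheta_isBigO_iff_forall_quasiRiemannHypothesis hΘ).2 hall ε hε⟩

end Literature.NumberTheory.LFunctions

end
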